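import Literature.NumberTheory.EllipticCurves.CoeffExtensionScalarFormPerfectProofs
import Literature.NumberTheory.EllipticCurves.ZpExtensionShapiroFrobeniusData
import Literature.NumberTheory.EllipticCurves.ZpExtensionShapiroSetting
import Literature.NumberTheory.EllipticCurves.ZpExtensionEisensteinDVRSettingDualityDataUnitTwistProofs
import HarnessLib

/-!
# The H.4 duality datum of Howard's Shapiro levels `𝐓_j = E_K[p^{j+1}] ⊗ Λ/(ω_{j+1}, p^{j+1})` as a
# `Howard2004.DualityDatum` — the inhabitant `Dsrc` of the Λ-adic SOURCE setting `S_Λ`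

Topic `NumberTheory/EllipticCurves` (the `Λ/(ω_k, p^k)`-twin of `ZpExtensionEisensteinTwistDualityDatum` / of
`ZpExtensionEisensteinDVRSettingDualityDataProofs` §3; sequel of `CoeffExtensionScalarFormPerfectProofs` (generic perfectness),
`ZpExtensionShapiroFrobeniusData` (Frobenius data on `Λ/(ω_k, p^k)`), `ZpExtensionShapiroSetting` (lit's `W.shapiroTower K p κ₀`,
`W.shapiroSetting … cd πbar D fs`) and `WeilConjugatePairingTowerProofs` (the `E`-level Weil–`τ` forms)). Definitions with bodies +
theorems; no named fact, no instance, no notation, no `sorry`.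

Howard [Compositio 140 (2004) §1.3 H.4, arXiv:1202.6340 p. 7 L69–80]: «a perfect, symmetric, `R`-bilinear pairing `T × T → R(1)`
with `(s^σ, t^{τστ⁻¹}) = (s, t)^σ`»; Prop. 2.2.4 [arXiv p0016]: «there is a perfect symmetric pairing `e_Λ : 𝐓 × 𝐓 → Λ(1)` …
`e_Λ(λ(t₁ ⊗ α₁), t₂ ⊗ α₂) = e_Λ(t₁ ⊗ α₁, λ^ι(t₂ ⊗ α₂))`», obtained from Lemma 2.1.1 (`e(t₁ ⊗ α₁, t₂ ⊗ α₂) = e_Weil(t₁, t₂^τ) α₁ α₂`)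
level by level.  The cite-only fact CGLS 2022 Thm. 4.1.1 (tree `CastellaGrossiLeeSkinner2022.thm411_exists_kolyvaginSystem_one_ne_zero`)
is typed on lit's `thm411Setting N W K p κ γ hyp jbar π P hP cd πbar Dsrc`, universally in the presentation slot
`Dsrc : ∀ j, DualityDatum p cd ((W.shapiroTower K p (κ.unitTwist (-1))).ρ j) (Λ ⧸ shapiroIdeal p (j+1))`; to APPLY it the caller
must exhibit such a `Dsrc`.  This file constructs it:

* §1 **`ZpExtension.shapiroTwistOne p k : DiscreteGaloisModule K (Λ/(ω_k, p^k))`** — `R(1)`, `g` acting by `ι(χ_cyc(g) mod p^k)`,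
  with the PINNED form `shapiroTwistOne_apply` (`= algebraMap ℤ_[p] R (χ_cyc g) * r`);
* §2 **`ZpExtension.scalarForm_coeffTwist_equivariant`** (generic coefficient ring `A`, unit `u` with `u^{p^J} = 1`):
  `e(g s, (c g) t) = ι(χ̄ g) e(s, t)` for `e = scalarForm ι eb` and the twist `κ'.coeffTwist ρ u J` on both slots, given the
  `E`-level equivariance of `eb` and OPPOSITE exponents `p^J ∣ e_J(g) + e_J(c g)` (the Eisenstein case is
  `eisensteinDualityForm_equivariant`);
* §3 **`ZpExtension.shapiroDualityDatum k cd κ' ρ eb … : DualityDatum p cd (κ'.coeffTwist ρ [1+T] k _) (Λ ⧸ shapiroIdeal p k)`**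
  for an `E`-level form `eb : M × M → ℤ/p^k` (symmetric, `(g, τgτ⁻¹)`-equivariant with the mod-`p^k` cyclotomic factor,
  left-non-degenerate, exhausting) and opposite exponents of `κ'` along `cd.conj`: `e := scalarForm (shapiroOfZMod p k) eb`,
  `perfect` ← `scalarForm_bijective_of_expansion` fed with the Frobenius data of `ZpExtensionShapiroFrobeniusData`, `equivariant` ← §2,
  `twistOne` ← §1 (`shapiroDualityDatum_e`, `_e_tmul_tmul`);
* §4 **the inhabitant**: for `E = W/ℚ` elliptic, `K` totally complex, `κ₀` anticyclotomic, `cd.τ` the transport of a complex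
  conjugation `c₀ ∈ Γ_ℚ`: `WeierstrassCurve.exists_shapiroDualityData` (∃ `D : ∀ j, DualityDatum p cd ((W.shapiroTower K p κ₀).ρ j)
  (Λ ⧸ shapiroIdeal p (j+1))` with `(D j).e = scalarForm ι_{j+1} ẽ_{j+1}`, `ẽ_j = conjPairing (e_j) τ_* log_j` the Weil–`τ` forms of
  `exists_conjPairing_tower`, together with their raw facts and level compatibility), the TERM
  **`WeierstrassCurve.shapiroDualityData W κ₀ cd … : ∀ j, DualityDatum p cd ((W.shapiroTower K p κ₀).ρ j) (Λ ⧸ shapiroIdeal p (j+1))`**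
  and its unit-twist form **`shapiroDualityDataUnitTwist W κ u cd …`** on `(W.shapiroTower K p (κ.unitTwist u)).ρ j` — at `u = -1`
  literally the `Dsrc` slot of `thm411Setting` / `shapiroSettingTame`.

Cell `pub/bsd-print-x9`, shared μ-crux `MuInequalityCoherentPairOfHoward` (stub_howardInputs, KS conjunct: applying (F-411) on `S_Λ`).
Not here: the local self-orthogonality clause `DualityDatum.IsSelfOrthogonal` of H.4 for `𝓕_Λ` (not needed: the source of a
push-forward carries no hypotheses), Howard's `Λ`-adic `e_Λ` as a limit. BSD is not proved by any of this.

References: [Howard2004HeegnerKolyvagin] B. Howard, Compositio Math. 140 (2004), §1.3 (H.4), Rem. 1.3.2, Lemma 2.1.1, §2.2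
Def. 2.2.3, Prop. 2.2.4 (arXiv:1202.6340 pp. 7, 16); [CastellaGrossiLeeSkinner2022] §3.4 (`𝐓 ≃ T_pE ⊗ Λ`, `Ψ⁻¹`), Thm. 4.1.1;
[SilvermanAEC2009] Prop. III.8.1; [Washington1997] §13.2; [Greenberg1999LNM] §1 (anticyclotomic twists).
-/

noncomputable section

open scoped TensorProduct
open Field

universe u

namespace Literature.NumberTheory.EllipticCurves

open Literature.NumberTheory.GaloisRepresentations Literature.NumberTheory.GaloisRepresentations.DiscreteGaloisModule
open Literature.NumberTheory.GaloisCohomology.Howard2004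

namespace ZpExtension

/-! ## §1 `R(1)` on the Shapiro level ring `R = Λ/(ω_k, p^k)` -/

section TwistOne

variable {K : Type} [Field K] (p : ℕ) [hp : Fact p.Prime] (k : ℕ)

/-- The representation `g ↦ (r ↦ ι(χ_cyc(g) mod p^k) · r)` of `Γ_K` on `Λ/(ω_k, p^k)` underlying `R(1)`.
[cite: Howard2004HeegnerKolyvagin, §1.3 (H.4: the Tate twist R(1))] -/
def shapiroTwistOneRepresentation :
    Representation ℤ (absoluteGaloisGroup K) (IwasawaAlgebra p ⧸ shapiroIdeal p k) where
  toFun g := (AddMonoidHom.mulLeft (shapiroOfZMod p k (cyclotomicCharacterModPow K p k g))).toIntLinearMap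
  map_one' := by
    refine LinearMap.ext fun r => ?_
    simp [map_one]
  map_mul' g h := by
    refine LinearMap.ext fun r => ?_
    simp [map_mul, mul_assoc]

/-- Unfolding: `shapiroTwistOneRepresentation g r = ι(χ̄ g) * r`. [cite: Howard2004HeegnerKolyvagin, §1.3 (H.4)] -/
@[simp]
theorem shapiroTwistOneRepresentation_apply_apply (g : absoluteGaloisGroup K) (r : IwasawaAlgebra p ⧸ shapiroIdeal p k) :
    shapiroTwistOneRepresentation (K := K) p k g r = shapiroOfZMod p k (cyclotomicCharacterModPow K p k g) * r :=
  rfl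

/-- **`Λ/(ω_k, p^k)(1)`** — the Shapiro level ring with `Γ_K` acting through the `p`-adic cyclotomic character reduced modulo `p^k`
(a discrete Galois module: the stabiliser of `r` contains the open kernel of `χ_cyc mod p^k`).
[cite: Howard2004HeegnerKolyvagin, §1.3 (H.4: «R(1) the Tate twist of the module R with trivial Galois action») and Prop. 2.2.4 (Λ(1))] -/
def shapiroTwistOne : DiscreteGaloisModule K (IwasawaAlgebra p ⧸ shapiroIdeal p k) :=
  ContinuousRep.ofStabilizerMemNhdsOne (shapiroTwistOneRepresentation (K := K) p k) fun r => by
    have h1 : {σ : absoluteGaloisGroup K | cyclotomicCharacterModPow K p k σ = 1} ∈ nhds (1 : absoluteGaloisGroup K) :=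
      ((isOpen_discrete ({1} : Set (ZMod (p ^ k)))).preimage
        (continuous_cyclotomicCharacterModPow K p k)).mem_nhds (by simp)
    filter_upwards [h1] with σ hσ
    rw [shapiroTwistOneRepresentation_apply_apply, hσ, map_one, one_mul]

/-- **`twistOne_apply` (PINNED form)**: `g · r = algebraMap ℤ_[p] (Λ/(ω_k, p^k)) (χ_cyc g) * r`.
[cite: Howard2004HeegnerKolyvagin, §1.3 (H.4)] -/
theorem shapiroTwistOne_apply (g : absoluteGaloisGroup K) (r : IwasawaAlgebra p ⧸ shapiroIdeal p k) :
    shapiroTwistOne (K := K) p k g r =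
      algebraMap ℤ_[p] (IwasawaAlgebra p ⧸ shapiroIdeal p k) ((GaloisRep.cyclotomicCharacter K p g : ℤ_[p]ˣ) : ℤ_[p]) * r := by
  change shapiroTwistOneRepresentation (K := K) p k g r = _
  rw [shapiroTwistOneRepresentation_apply_apply, algebraMap_padicInt_quotient_shapiroIdeal, cyclotomicCharacterModPow_apply]

end TwistOne

/-! ## §2 Equivariance of the scalar form under `coeffTwist` with opposite exponents -/

section Equivariant

variable {K : Type u} [Field K] {p : ℕ} [hp : Fact p.Prime] (κ' : ZpExtension K p) {A : Type} [CommRing A] {n : ℕ}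
  (ι : ZMod n →+* A) {u' : A} {J : ℕ} (hu : u' ^ (p ^ J) = 1)
  {M : Type u} [AddCommGroup M] [TopologicalSpace M] [DiscreteTopology M] (ρ : DiscreteGaloisModule K M)
  (c : absoluteGaloisGroup K → absoluteGaloisGroup K) (χbar : absoluteGaloisGroup K → ZMod n) (eb : M →+ M →+ ZMod n)
  (heb : ∀ (g : absoluteGaloisGroup K) (a b : M), eb (ρ g a) (ρ (c g) b) = χbar g * eb a b)
  (hκ : ∀ g : absoluteGaloisGroup K, p ^ J ∣ κ'.twistExponent J g + κ'.twistExponent J (c g))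

include hu hκ in
/-- Opposite exponents cancel: `u^{e_J(g)} u^{e_J(c g)} = 1` when `p^J ∣ e_J(g) + e_J(c g)` and `u^{p^J} = 1`.
[cite: Howard2004HeegnerKolyvagin, §2.2 (the anticyclotomic character)] [cite: Washington1997, §13.1–§13.2] -/
theorem pow_twistExponent_mul_pow_twistExponent_conj_eq_one (g : absoluteGaloisGroup K) :
    u' ^ κ'.twistExponent J g * u' ^ κ'.twistExponent J (c g) = 1 := by
  obtain ⟨t, ht⟩ := hκ g
  rw [← pow_add, ht, pow_mul, hu, one_pow]

include heb hκ in
/-- **Equivariance of the scalar form under `coeffTwist`** (generic coefficient ring `A`): `e (ρ' g s) (ρ' (c g) t) = ι(χ̄ g) * e s t`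
for `e = scalarForm ι eb` and `ρ' = κ'.coeffTwist ρ u J` on BOTH slots, `c g` on the second, given the `E`-level equivariance of `eb`
and opposite exponents (the factors `u^{e(g)} u^{e(cg)}` cancel).  The Eisenstein case `A = A_{m,k}`, `u = 1 + T` is
`eisensteinDualityForm_equivariant`. [cite: Howard2004HeegnerKolyvagin, §1.3 (H.4: (s^σ, t^{τστ⁻¹}) = (s,t)^σ) and Lemma 2.1.1] -/
theorem scalarForm_coeffTwist_equivariant (g : absoluteGaloisGroup K) (s t : CoeffExtension ℤ A M) :
    scalarForm ι eb (κ'.coeffTwist ρ u' J hu g s) (κ'.coeffTwist ρ u' J hu (c g) t) = ι (χbar g) * scalarForm ι eb s t := by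
  rw [scalarForm_apply_apply, scalarForm_apply_apply]
  induction s using CoeffExtension.induction_on with
  | zero => simp only [map_zero, AddMonoidHom.zero_apply, mul_zero]
  | tmul c₁ a₁ =>
    induction t using CoeffExtension.induction_on with
    | zero => simp only [map_zero, mul_zero]
    | tmul c₂ a₂ =>
      rw [coeffTwist_apply_tmul, coeffTwist_apply_tmul, scalarFormHom_tmul_tmul, scalarFormHom_tmul_tmul, heb, map_mul]
      have hu1 := pow_twistExponent_mul_pow_twistExponent_conj_eq_one κ' hu c hκ g
      calc _ = (u' ^ κ'.twistExponent J g * u' ^ κ'.twistExponent J (c g)) * (ι (χbar g) * (c₁ * c₂ * ι (eb a₁ a₂))) := by ring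
        _ = _ := by rw [hu1, one_mul]
    | add y y' hy hy' => rw [map_add, map_add, map_add, hy, hy', mul_add]
  | add x x' hx hx' =>
    rw [map_add, map_add, AddMonoidHom.add_apply, map_add, AddMonoidHom.add_apply, hx, hx', mul_add]

end Equivariant

/-! ## §3 The H.4 datum of `M ⊗ Λ/(ω_k, p^k)(χ)` -/

section Datum

variable {K : Type} [Field K] [NumberField K] {p : ℕ} [hp : Fact p.Prime] (k : ℕ) (cd : ConjugationDatum K)
  (κ' : ZpExtension K p) {M : Type} [AddCommGroup M] [TopologicalSpace M] [DiscreteTopology M]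
  (ρ : DiscreteGaloisModule K M) (eb : M →+ M →+ ZMod (p ^ k))

/-- **Opposite exponents along `cd.conj`** for an anticyclotomic `κ'`, `K` totally complex and `cd.τ` a transported complex
conjugation: `p^J ∣ e_J(g) + e_J(τ⁻¹ g τ)` at every `J` (the `hκ` input of `shapiroDualityDatum`; the Eisenstein file's
`eisensteinDualityDatum_hκ_of_isAnticyclotomic` is the case `J = eisensteinLevel`). [cite: Howard2004HeegnerKolyvagin, §2.2 (the anticyclotomic character)]
[cite: Greenberg1999LNM, §1] -/
theorem twistExponent_add_twistExponent_conj_dvd_of_isAnticyclotomic (hκ' : κ'.IsAnticyclotomic)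
    (himag : ∀ w : NumberField.InfinitePlace K, w.IsComplex) {c₀ : absoluteGaloisGroup ℚ}
    (hc₀ : IsComplexConjugation (Rat.castHom ℝ) c₀) (hτ : ∀ x, cd.τ x = absGaloisTransport (K := ℚ) (L := K) c₀ x)
    (J : ℕ) (g : absoluteGaloisGroup K) :
    p ^ J ∣ κ'.twistExponent J g + κ'.twistExponent J (cd.conj g) :=
  twistExponent_add_twistExponent_conj_dvd κ' cd.conj (fun g ↦ toAdd_conjGalCMH_eq_neg κ' hκ' himag cd.isLift hc₀ hτ g) J g

/-- **The H.4 duality datum of the Shapiro-type level `M ⊗ Λ/(ω_k, p^k)(χ_{κ'})`** (`M = E_K[p^k]`: Howard's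
`Ind_{K_k/K} E[p^k] = 𝐓/I_k 𝐓` with the pairing `e(t₁ ⊗ α₁, t₂ ⊗ α₂) = e_W(t₁, t₂^τ) α₁ α₂`), assembled BY NAME: `e := scalarForm
(shapiroOfZMod p k) eb`, `symm` ← `scalarForm_flip`, `perfect` ← `scalarForm_bijective_of_expansion` fed with the Frobenius data
(`shapiroTailFormZMod`, `shapiroPowFamily`, `shapiroDualFamily`) of `Λ/(ω_k, p^k)`, `equivariant` ← `scalarForm_coeffTwist_equivariant`,
`twistOne` ← `shapiroTwistOne`.  Inputs: an `E`-level form `ẽ : M × M → ℤ/p^k` symmetric, `(g, τgτ⁻¹)`-equivariant with the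
mod-`p^k` cyclotomic factor, left-non-degenerate and exhausting `Hom(M, ℤ/p^k)`, and OPPOSITE twist exponents of `κ'` along `cd.conj`.
[cite: Howard2004HeegnerKolyvagin, §1.3 (H.4), Rem. 1.3.2, Lemma 2.1.1, §2.2 Def. 2.2.3 and Prop. 2.2.4] -/
def shapiroDualityDatum (hsymm : ∀ a b : M, eb a b = eb b a)
    (hequiv : ∀ (g : absoluteGaloisGroup K) (a b : M), eb (ρ g a) (ρ (cd.conj g) b) = cyclotomicCharacterModPow K p k g * eb a b)
    (hnd : ∀ w : M, (∀ b : M, eb w b = 0) → w = 0) (hex : ∀ φ : M →+ ZMod (p ^ k), ∃ w : M, ∀ b : M, eb w b = φ b)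
    (hκ : ∀ g : absoluteGaloisGroup K, p ^ k ∣ κ'.twistExponent k g + κ'.twistExponent k (cd.conj g)) :
    DualityDatum p cd
      (κ'.coeffTwist ρ (Ideal.Quotient.mk (shapiroIdeal p k) (1 + PowerSeries.X)) k
        (mk_one_add_X_pow_prime_pow_eq_one (shapiroIdeal p k) (omega_mem_shapiroIdeal p k)))
      (IwasawaAlgebra p ⧸ shapiroIdeal p k) where
  e := scalarForm (shapiroOfZMod p k) eb
  symm s t := scalarForm_flip (shapiroOfZMod p k) eb eb (fun a b => hsymm b a) t s
  perfect := scalarForm_bijective_of_expansion (shapiroOfZMod p k) (shapiroTailFormZMod p k).toAddMonoidHom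
    (shapiroPowFamily p k) (shapiroDualFamily p k) (shapiroTailFormZMod_powFamily_mul_dualFamily p k)
    (eq_sum_shapiroOfZMod_tailFormZMod_mul_powFamily p k) eb hnd hex
  equivariant g s t := by
    rw [algebraMap_padicInt_quotient_shapiroIdeal, ← cyclotomicCharacterModPow_apply]
    exact scalarForm_coeffTwist_equivariant κ' (shapiroOfZMod p k) _ ρ cd.conj (cyclotomicCharacterModPow K p k) eb hequiv hκ
      g s t
  twistOne := shapiroTwistOne (K := K) p k
  twistOne_apply := shapiroTwistOne_apply (K := K) p k

/-- The pairing of the datum is `scalarForm (shapiroOfZMod p k) eb` (by `rfl`). [cite: Howard2004HeegnerKolyvagin, Lemma 2.1.1] -/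
theorem shapiroDualityDatum_e (hsymm : ∀ a b : M, eb a b = eb b a)
    (hequiv : ∀ (g : absoluteGaloisGroup K) (a b : M), eb (ρ g a) (ρ (cd.conj g) b) = cyclotomicCharacterModPow K p k g * eb a b)
    (hnd : ∀ w : M, (∀ b : M, eb w b = 0) → w = 0) (hex : ∀ φ : M →+ ZMod (p ^ k), ∃ w : M, ∀ b : M, eb w b = φ b)
    (hκ : ∀ g : absoluteGaloisGroup K, p ^ k ∣ κ'.twistExponent k g + κ'.twistExponent k (cd.conj g)) :
    (shapiroDualityDatum k cd κ' ρ eb hsymm hequiv hnd hex hκ).e = scalarForm (shapiroOfZMod p k) eb :=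
  rfl

/-- On pure tensors (x9-p2's pinned `QuotTwisted.tmul`) the datum's pairing is Howard's formula
`(c₁ ⊗ a₁, c₂ ⊗ a₂) ↦ c₁ c₂ ι(ẽ(a₁, a₂))`. [cite: Howard2004HeegnerKolyvagin, Lemma 2.1.1 (e(t₁ ⊗ α₁, t₂ ⊗ α₂) = e(t₁, t₂^τ) ⊗ α₁α₂) and Prop. 2.2.4] -/
theorem shapiroDualityDatum_e_tmul_tmul (hsymm : ∀ a b : M, eb a b = eb b a)
    (hequiv : ∀ (g : absoluteGaloisGroup K) (a b : M), eb (ρ g a) (ρ (cd.conj g) b) = cyclotomicCharacterModPow K p k g * eb a b)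
    (hnd : ∀ w : M, (∀ b : M, eb w b = 0) → w = 0) (hex : ∀ φ : M →+ ZMod (p ^ k), ∃ w : M, ∀ b : M, eb w b = φ b)
    (hκ : ∀ g : absoluteGaloisGroup K, p ^ k ∣ κ'.twistExponent k g + κ'.twistExponent k (cd.conj g))
    (c₁ c₂ : IwasawaAlgebra p ⧸ shapiroIdeal p k) (a₁ a₂ : M) :
    (shapiroDualityDatum k cd κ' ρ eb hsymm hequiv hnd hex hκ).e (QuotTwisted.tmul c₁ a₁) (QuotTwisted.tmul c₂ a₂) =
      c₁ * c₂ * shapiroOfZMod p k (eb a₁ a₂) :=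
  scalarForm_tmul_tmul (shapiroOfZMod p k) eb c₁ c₂ a₁ a₂

end Datum

end ZpExtension

end Literature.NumberTheory.EllipticCurves

/-! ## §4 The inhabitant for `E/ℚ` over a totally complex `K`: `Dsrc` -/

namespace WeierstrassCurve

open Literature.NumberTheory.EllipticCurves Literature.NumberTheory.GaloisRepresentations
open Literature.NumberTheory.GaloisRepresentations.DiscreteGaloisModule
open Literature.NumberTheory.GaloisCohomology.Howard2004
open Literature.NumberTheory.EllipticCurves.ZpExtension

variable {K : Type} [Field K] [NumberField K] (W : WeierstrassCurve ℚ) [W.IsElliptic] {p : ℕ} [hp : Fact p.Prime]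
  (κ₀ : ZpExtension K p) (cd : ConjugationDatum K)

/-- **The H.4 data of the Shapiro SOURCE tower, instantiated from the Weil pairing and `τ`** (existence with properties).  Let
`E = W/ℚ` be elliptic, `K` a totally complex number field, `p` prime, `κ₀ : Γ_K ↠ ℤ_p` anticyclotomic (e.g. `κ.unitTwist (-1)`, CGLS's
`Ψ⁻¹`), `cd` a conjugation datum whose `τ` is the transport of a complex conjugation `c₀ ∈ Γ_ℚ`.  Then there are
`D j : DualityDatum p cd (𝐓_j) (Λ/(ω_{j+1}, p^{j+1}))` on the levels `𝐓_j = (W.shapiroTower K p κ₀).ρ j`, a bi-additive Weil family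
`e_j : E_K[p^j] × E_K[p^j] → μ_{p^j}(K̄)` and a compatible discrete logarithm `log_j` such that: (1) `(D j).e = scalarForm ι_{j+1} ẽ_{j+1}`
with `ẽ_j = conjPairing (e j) τ_* (log j)` — Howard's `e(t₁ ⊗ α₁, t₂ ⊗ α₂) = ι(log e(t₁, τ t₂)) α₁ α₂`; (2) `e_j(a, a) = 0`;
(3) `e_j(ga, gb) = g · e_j(a, b)`; (4) `e_j(τ_* a, τ_* b) = −e_j(a, b)`; (5) `τ_* τ_* = id`; (6) `log_j` bijective; (7) the level
compatibility `ẽ_j(p·a, p·b) = ẽ_{j+1}(a, b) mod p^j`; (8) the sign identity `ẽ_j(τ_* a, τ_* b) = −ẽ_j(a, b)`.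
[cite: Howard2004HeegnerKolyvagin, §1.3 H.4, Rem. 1.3.2, Lemma 2.1.1 and Prop. 2.2.4 (arXiv pp. 7, 16)] [cite: SilvermanAEC2009, Prop. III.8.1] -/
theorem exists_shapiroDualityData (hκ₀ : κ₀.IsAnticyclotomic) (himag : ∀ w : NumberField.InfinitePlace K, w.IsComplex)
    {c₀ : absoluteGaloisGroup ℚ} (hc₀ : IsComplexConjugation (Rat.castHom ℝ) c₀)
    (hτ : ∀ x, cd.τ x = absGaloisTransport (K := ℚ) (L := K) c₀ x) :
    ∃ (D : ∀ j, DualityDatum p cd ((W.shapiroTower K p κ₀).ρ j) (IwasawaAlgebra p ⧸ shapiroIdeal p (j + 1)))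
      (e : ∀ j : ℕ, geomTorsion (W.baseChange K) ((p : ℤ) ^ j) →+ geomTorsion (W.baseChange K) ((p : ℤ) ^ j) →+
        MuCarrier K (p ^ j))
      (log : ∀ j : ℕ, MuCarrier K (p ^ j) →+ ZMod (p ^ j)),
      (∀ j, (D j).e = scalarForm (shapiroOfZMod p (j + 1))
        (conjPairing (e (j + 1)) (cd.isLift.torsionMap W _) (log (j + 1)))) ∧
      (∀ j a, e j a a = 0) ∧
      (∀ j (g : absoluteGaloisGroup K) a b, e j (g • a) (g • b) = mu K (p ^ j) g (e j a b)) ∧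
      (∀ j a b, e j (cd.isLift.torsionMap W _ a) (cd.isLift.torsionMap W _ b) = -e j a b) ∧
      (∀ j (a : geomTorsion (W.baseChange K) ((p : ℤ) ^ j)),
        cd.isLift.torsionMap W _ (cd.isLift.torsionMap W _ a) = a) ∧
      (∀ j, Function.Bijective (log j)) ∧
      (∀ j a b, conjPairing (e j) (cd.isLift.torsionMap W _) (log j) ((W.baseChange K).geomTorsionReduce p j a)
            ((W.baseChange K).geomTorsionReduce p j b) =
          ZMod.castHom (pow_dvd_pow p j.le_succ) (ZMod (p ^ j))
            (conjPairing (e (j + 1)) (cd.isLift.torsionMap W _) (log (j + 1)) a b)) ∧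
      (∀ j a b, conjPairing (e j) (cd.isLift.torsionMap W _) (log j) (cd.isLift.torsionMap W _ a) (cd.isLift.torsionMap W _ b) =
        -conjPairing (e j) (cd.isLift.torsionMap W _) (log j) a b) := by
  obtain ⟨e, log, hW1, hW3, hW4, hθθ, hL1, hsymm, hequiv, hnd, hex, hcompat, hsign⟩ :=
    W.exists_conjPairing_tower p cd.isLift hc₀ hτ
  -- the `E`-level forms `ẽ_j = conjPairing (e j) τ_* (log j)` and the data `D j`
  let eb : ∀ j, geomTorsion (W.baseChange K) ((p : ℤ) ^ j) →+ geomTorsion (W.baseChange K) ((p : ℤ) ^ j) →+ ZMod (p ^ j) :=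
    fun j ↦ conjPairing (e j) (cd.isLift.torsionMap W _) (log j)
  have hκ' := ZpExtension.twistExponent_add_twistExponent_conj_dvd_of_isAnticyclotomic cd κ₀ hκ₀ himag hc₀ hτ
  let D : ∀ j, DualityDatum p cd ((W.shapiroTower K p κ₀).ρ j) (IwasawaAlgebra p ⧸ shapiroIdeal p (j + 1)) := fun j ↦
    ZpExtension.shapiroDualityDatum (j + 1) cd κ₀ ((W.baseChange K).torsionGaloisModule ((p : ℤ) ^ (j + 1)))
      (eb (j + 1)) (hsymm (j + 1)) (hequiv (j + 1)) (hnd (j + 1)) (hex (j + 1)) (hκ' (j + 1))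
  have hDe : ∀ j, (D j).e = scalarForm (shapiroOfZMod p (j + 1)) (eb (j + 1)) := fun j ↦
    ZpExtension.shapiroDualityDatum_e (j + 1) cd κ₀ _ (eb (j + 1)) (hsymm (j + 1)) (hequiv (j + 1)) (hnd (j + 1))
      (hex (j + 1)) (hκ' (j + 1))
  exact ⟨D, e, log, hDe, hW1, hW3, hW4, hθθ, hL1, hcompat, hsign⟩

/-- **`Dsrc` — the H.4 datum of the Shapiro SOURCE tower as a TERM**: `W.shapiroDualityData κ₀ cd hκ₀ himag hc₀ hτ j :
DualityDatum p cd ((W.shapiroTower K p κ₀).ρ j) (Λ ⧸ shapiroIdeal p (j+1))` (a choice from `exists_shapiroDualityData`).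
[cite: Howard2004HeegnerKolyvagin, §1.3 H.4 and Prop. 2.2.4] -/
def shapiroDualityData (hκ₀ : κ₀.IsAnticyclotomic) (himag : ∀ w : NumberField.InfinitePlace K, w.IsComplex)
    {c₀ : absoluteGaloisGroup ℚ} (hc₀ : IsComplexConjugation (Rat.castHom ℝ) c₀)
    (hτ : ∀ x, cd.τ x = absGaloisTransport (K := ℚ) (L := K) c₀ x) (j : ℕ) :
    DualityDatum p cd ((W.shapiroTower K p κ₀).ρ j) (IwasawaAlgebra p ⧸ shapiroIdeal p (j + 1)) :=
  (W.exists_shapiroDualityData κ₀ cd hκ₀ himag hc₀ hτ).choose j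

/-- The pairing of `Dsrc` is a scalar form of a Weil–`τ` form `ẽ_{j+1} = conjPairing e_{j+1} τ_* log_{j+1}` with the properties (2)–(8) of
`exists_shapiroDualityData`. [cite: Howard2004HeegnerKolyvagin, §1.3 H.4, Rem. 1.3.2 and Prop. 2.2.4] -/
theorem shapiroDualityData_spec (hκ₀ : κ₀.IsAnticyclotomic) (himag : ∀ w : NumberField.InfinitePlace K, w.IsComplex)
    {c₀ : absoluteGaloisGroup ℚ} (hc₀ : IsComplexConjugation (Rat.castHom ℝ) c₀)
    (hτ : ∀ x, cd.τ x = absGaloisTransport (K := ℚ) (L := K) c₀ x) :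
    ∃ (e : ∀ j : ℕ, geomTorsion (W.baseChange K) ((p : ℤ) ^ j) →+ geomTorsion (W.baseChange K) ((p : ℤ) ^ j) →+
        MuCarrier K (p ^ j))
      (log : ∀ j : ℕ, MuCarrier K (p ^ j) →+ ZMod (p ^ j)),
      (∀ j, (W.shapiroDualityData κ₀ cd hκ₀ himag hc₀ hτ j).e = scalarForm (shapiroOfZMod p (j + 1))
        (conjPairing (e (j + 1)) (cd.isLift.torsionMap W _) (log (j + 1)))) ∧
      (∀ j a, e j a a = 0) ∧
      (∀ j (g : absoluteGaloisGroup K) a b, e j (g • a) (g • b) = mu K (p ^ j) g (e j a b)) ∧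
      (∀ j a b, e j (cd.isLift.torsionMap W _ a) (cd.isLift.torsionMap W _ b) = -e j a b) ∧
      (∀ j (a : geomTorsion (W.baseChange K) ((p : ℤ) ^ j)),
        cd.isLift.torsionMap W _ (cd.isLift.torsionMap W _ a) = a) ∧
      (∀ j, Function.Bijective (log j)) ∧
      (∀ j a b, conjPairing (e j) (cd.isLift.torsionMap W _) (log j) ((W.baseChange K).geomTorsionReduce p j a)
            ((W.baseChange K).geomTorsionReduce p j b) =
          ZMod.castHom (pow_dvd_pow p j.le_succ) (ZMod (p ^ j))
            (conjPairing (e (j + 1)) (cd.isLift.torsionMap W _) (log (j + 1)) a b)) ∧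
      (∀ j a b, conjPairing (e j) (cd.isLift.torsionMap W _) (log j) (cd.isLift.torsionMap W _ a) (cd.isLift.torsionMap W _ b) =
        -conjPairing (e j) (cd.isLift.torsionMap W _) (log j) a b) :=
  (W.exists_shapiroDualityData κ₀ cd hκ₀ himag hc₀ hτ).choose_spec

/-- **`Dsrc` at a unit twist** `κ.unitTwist u` of an anticyclotomic `κ` — at `u = -1` literally the presentation slot
`Dsrc : ∀ j, DualityDatum p cd ((W.shapiroTower K p (κ.unitTwist (-1))).ρ j) (Λ ⧸ shapiroIdeal p (j+1))` of lit's `thm411Setting` /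
`shapiroSettingTame` (CGLS's `𝐓 = T_pE ⊗ Λ(Ψ⁻¹)`). [cite: Howard2004HeegnerKolyvagin, §1.3 H.4 and Prop. 2.2.4]
[cite: CastellaGrossiLeeSkinner2022, §3.4 (𝐓 ≃ T_pE ⊗ Λ, Ψ⁻¹) and Thm. 4.1.1] -/
def shapiroDualityDataUnitTwist (κ : ZpExtension K p) (u : ℤ_[p]ˣ) (hκ : κ.IsAnticyclotomic)
    (himag : ∀ w : NumberField.InfinitePlace K, w.IsComplex) {c₀ : absoluteGaloisGroup ℚ}
    (hc₀ : IsComplexConjugation (Rat.castHom ℝ) c₀) (hτ : ∀ x, cd.τ x = absGaloisTransport (K := ℚ) (L := K) c₀ x) (j : ℕ) :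
    DualityDatum p cd ((W.shapiroTower K p (κ.unitTwist u)).ρ j) (IwasawaAlgebra p ⧸ shapiroIdeal p (j + 1)) :=
  W.shapiroDualityData (κ.unitTwist u) cd (hκ.unitTwist u) himag hc₀ hτ j

end WeierstrassCurve

end
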